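import Summits.FinalStateConjecture.FinalStateConjecture.Theorems.ClusterCompletenessRecurrentlyFlatDispersesFutureSetExit
import Literature.Geometry.Manifold.InverseFunctionTheorem

/-!
# Crux `RecurrentlyFlatDisperses` (stmt-FinalStateConjecture-14665), line `Sketch`
# (card `outgoing-blind-cup-restart`) — registered stub `stub_futureSet`

FUTURE SET (the card's First lemma): given the pointwise anchor (`AnchorCone`, first hypothesis)
and the orientation of the chart time (`ChartFuture`, second hypothesis), the late chart image
`W = Ψ₀{x⁰ > τ₀}` of an anchored flat late chart of a maximal vacuum Cauchy development is a future
set, `I⁺(W) ⊆ W`, and the chronological future of a late slab `Ψ₀{x⁰ = τ}` lies in the chart above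
it, `I⁺(Ψ₀{x⁰ = τ}) ⊆ Ψ₀{x⁰ > τ}`.

Proof (first-exit argument along a future timelike curve `γ` from `W`). The chart restricted to the
late half-space `V = {x⁰ > τ₀}`, `Φ = Ψ₀|V : V → 𝒟`, is a smooth injective local diffeomorphism
(the anchor `‖Ψ₀^* g − η‖ ≤ 1/4` makes `dΨ₀` injective; inverse function theorem on manifolds,
`Literature.Geometry.Manifold.isLocalDiffeomorphAt_of_mfderiv`), so inside `W = Φ(V)` the curve
lifts (`mdifferentiableAt_invFun_comp_and_mfderiv`, `TimelikeCurveLiftLocal.lean`) to a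
differentiable coordinate curve `c = Φ⁻¹ ∘ γ` with `dΨ₀(c') = γ'`. CONE ESTIMATE: for a form
`G = η + dev`, `‖dev‖ ≤ 1/4`, a vector `w` with `G(w, w) < 0` and `G(∂₀, w) < 0` (both `dΨ₀ ∂₀` and
`γ'` are future-directed, the former timelike, so `g(dΨ₀ ∂₀, γ') < 0`: O'Neill 1983, Ch. 5,
Lemma 5.29, `TimeOrientation.IsFutureDirected.val_lt_zero`) has `w⁰ > 0` and `‖w‖ < 2 w⁰`; so the
chart time `c⁰` is strictly increasing and `‖c(s₂) − c(s₁)‖ ≤ 2 (c⁰(s₂) − c⁰(s₁))`. At the first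
exit parameter `σ` of `γ` from the open set `W`: if `c⁰` is bounded on `[a, σ)` the lift is Cauchy
and converges in `V`, so `γ σ ∈ W` (Hausdorff limit), contradiction; if `c⁰` is unbounded, the
anchored vertical rays `r ↦ Φ(c(s) + δ(eʳ − 1)∂₀)` below `γ(s)` are future causal curves of speed
`≥ 1/2` (`g(dΨ₀ ∂₀, dΨ₀ ∂₀) ≤ −3/4`) inside the compact `J⁻(γ σ) ∩ J⁺(Σ)`
(`CauchyDevelopment.isCompact_causalPast_inter_causalFuture_range`, transitivity
`causalFuture_causalFuture_eq`) of length `≥ (log δ)/2 → ∞`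
(`PseudoRiemannianMetric.ofReal_mul_le_arcLength`), against the uniform bound
`IsStronglyCausal.exists_arcLength_le_of_isCompact` in the strongly causal development
(`CauchyDevelopment.isStronglyCausal`; O'Neill 1983, Ch. 14, Lemma 14.14). The second conjunct
follows from the first and the monotonicity of the chart time. Parts 1–2 (the cone estimate and the
lift; the first-exit argument) are the support files `…RecurrentlyFlatDispersesFutureSetCone`,
`…RecurrentlyFlatDispersesFutureSetExit`; this file assembles them for the anchored chart `Ψ₀`
restricted to `{x⁰ > τ₀}` (an injective local diffeomorphism by the inverse function theorem,
`Literature.Geometry.Manifold.isLocalDiffeomorphAt_of_mfderiv`). Mathlib + the Literature cone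
only; no definitions, no named facts.
-/

noncomputable section

open scoped Manifold ContDiff Topology
open Bundle Filter Set Function TopologicalSpace Literature.Geometry.Lorentzian

namespace Summit.FinalStateConjecture.FinalStateConjecture.Theorems.RecurrentlyFlatDisperses

namespace FutureSet

/-- **Endpoints of future timelike curves from the chart image are charted, at a later chart
time.** -/
private theorem exists_endpoint {𝓢 : Spacetime 4} {V : Opens E4} [Nonempty V]
    {Φ : V → 𝓢.carrier} {τ₀ : ℝ} (hΦs : ContMDiff 𝓘(ℝ, E4) (𝓡 4) ∞ Φ) (hinj : Injective Φ)
    (hloc : IsLocalDiffeomorph 𝓘(ℝ, E4) (𝓡 4) ∞ Φ)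
    (hcone : ∀ (x : V) (w : E4), 𝓢.metric.IsTimelike (mfderiv 𝓘(ℝ, E4) (𝓡 4) Φ x w) →
      𝓢.timeOrientation.IsFutureDirected (mfderiv 𝓘(ℝ, E4) (𝓡 4) Φ x w) →
      0 < w 0 ∧ ‖w‖ < 2 * w 0)
    (hVmem : ∀ p : E4, p ∈ V ↔ τ₀ < p 0) (hWopen : IsOpen (range Φ))
    (hvert : ∀ x : V, 𝓢.metric.val (Φ x) (mfderiv 𝓘(ℝ, E4) (𝓡 4) Φ x (E4.basisVector 0))
        (mfderiv 𝓘(ℝ, E4) (𝓡 4) Φ x (E4.basisVector 0)) ≤ -(3 / 4) ∧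
      𝓢.timeOrientation.IsFutureDirected (mfderiv 𝓘(ℝ, E4) (𝓡 4) Φ x (E4.basisVector 0)))
    (hsc : 𝓢.metric.IsStronglyCausal 𝓢.timeOrientation) {S : Set 𝓢.carrier}
    (hK : ∀ q : 𝓢.carrier, IsCompact (𝓢.metric.causalPast 𝓢.timeOrientation {q} ∩
      𝓢.metric.causalFuture 𝓢.timeOrientation S))
    (hWS : range Φ ⊆ 𝓢.metric.causalFuture 𝓢.timeOrientation S)
    {γ : ℝ → 𝓢.carrier} {a b : ℝ} (hab : a < b)
    (hγ : 𝓢.metric.IsFutureTimelikeCurveOn 𝓢.timeOrientation γ (Icc a b))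
    (x₀ : V) (ha : γ a = Φ x₀) : ∃ x₁ : V, γ b = Φ x₁ ∧ (x₀ : E4) 0 < (x₁ : E4) 0 := by
  have hstay := forall_mem_range hΦs hinj hloc hcone hVmem hWopen hvert hsc hK hWS hγ ⟨x₀, ha.symm⟩
  set c : ℝ → E4 := fun t ↦ ((Function.invFun Φ (γ t) : V) : E4) with hc
  have hder : ∀ t ∈ Icc a b, HasDerivAt c (deriv c t) t ∧ 0 < deriv c t 0 := fun t ht ↦ by
    obtain ⟨hd, h1, -⟩ := lift_cone hΦs hinj hloc hcone (hγ t ht) (hstay t ht)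
    exact ⟨hd.hasDerivAt, h1⟩
  have hmono : StrictMonoOn (fun t ↦ c t 0) (Icc a b) :=
    strictMonoOn_apply_zero (w := fun t ↦ deriv c t) (convex_Icc a b) hder
  have h0 : Function.invFun Φ (γ a) = x₀ := by
    rw [ha]
    exact Function.leftInverse_invFun hinj x₀
  refine ⟨Function.invFun Φ (γ b), (Function.invFun_eq (hstay b ⟨hab.le, le_rfl⟩)).symm, ?_⟩
  have h1 : c a 0 < c b 0 := hmono ⟨le_rfl, hab.le⟩ ⟨hab.le, le_rfl⟩ hab
  have h2 : c a = (x₀ : E4) := by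
    show ((Function.invFun Φ (γ a) : V) : E4) = (x₀ : E4)
    rw [h0]
  rw [h2] at h1
  exact h1

/-! ### Assembly for an anchored late chart -/

/-- **Future-set property of an anchored late chart.** Let `Ψ₀ : U₀ → 𝓢` be a smooth map on an
open `U₀ ⊇ {x⁰ > τ₀}` of `E4` which is an open embedding on the late region `{x⁰ > τ₀}`, anchored
(`‖Ψ₀^* g − η‖ ≤ 1/4` pointwise on the late region) with `dΨ₀ ∂₀` future-directed there, whose late
image `W` lies in `J⁺(S)` for a set `S` with all `J⁻(q) ∩ J⁺(S)` compact, in a strongly causal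
spacetime. Then `I⁺(W) ⊆ W`, and `I⁺(Ψ₀{x⁰ = τ}) ⊆ Ψ₀{x⁰ > τ}` for `τ > τ₀`. -/
private theorem futureSet_of_chart {𝓢 : Spacetime 4}
    (hsc : 𝓢.metric.IsStronglyCausal 𝓢.timeOrientation) {S : Set 𝓢.carrier}
    (hK : ∀ q : 𝓢.carrier, IsCompact (𝓢.metric.causalPast 𝓢.timeOrientation {q} ∩
      𝓢.metric.causalFuture 𝓢.timeOrientation S))
    {U₀ : Opens E4} {Ψ₀ : U₀ → 𝓢.carrier} {τ₀ : ℝ}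
    (hΨs : ContMDiff 𝓘(ℝ, E4) (𝓡 4) ∞ Ψ₀)
    (hemb : Topology.IsOpenEmbedding (((Minkowski.backgroundOn U₀).lateRegion τ₀).restrict Ψ₀))
    (hU : {x : E4 | τ₀ < x 0} ⊆ (U₀ : Set E4))
    (hdev : ∀ y : U₀, τ₀ < y.1 0 → ‖𝓢.deviation (Minkowski.backgroundOn U₀) Ψ₀ y‖ ≤ 1 / 4)
    (hfut : ∀ y : U₀, τ₀ < y.1 0 →
      𝓢.timeOrientation.IsFutureDirected (mfderiv 𝓘(ℝ, E4) (𝓡 4) Ψ₀ y (E4.basisVector 0)))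
    (hWS : Ψ₀ '' (Minkowski.backgroundOn U₀).lateRegion τ₀ ⊆
      𝓢.metric.causalFuture 𝓢.timeOrientation S) :
    (𝓢.metric.chronologicalFuture 𝓢.timeOrientation
        (Ψ₀ '' (Minkowski.backgroundOn U₀).lateRegion τ₀) ⊆
      Ψ₀ '' (Minkowski.backgroundOn U₀).lateRegion τ₀) ∧
    (∀ τ : ℝ, τ₀ < τ →
      𝓢.metric.chronologicalFuture 𝓢.timeOrientation
          (Ψ₀ '' (Minkowski.backgroundOn U₀).timeSlab τ) ⊆
        Ψ₀ '' (Minkowski.backgroundOn U₀).lateRegion τ) := by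
  -- the late half-space `V` and the chart `Φ = Ψ₀|V`
  obtain ⟨V, hVmem⟩ : ∃ V : Opens E4, ∀ p : E4, p ∈ V ↔ τ₀ < p 0 :=
    ⟨⟨{x : E4 | τ₀ < x 0}, isOpen_lt continuous_const (PiLp.continuous_apply 2 _ 0)⟩,
      fun _ ↦ Iff.rfl⟩
  have hVU : V ≤ U₀ := fun p hp ↦ hU ((hVmem p).1 hp)
  haveI : Nonempty V :=
    ⟨⟨(τ₀ + 1) • (E4.basisVector 0 : E4), (hVmem _).2 (by simp [E4.basisVector])⟩⟩
  have hlate : ∀ x : V, τ₀ < (Opens.inclusion hVU x).1 0 := fun x ↦ (hVmem x.1).1 x.2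
  set Φ : V → 𝓢.carrier := Ψ₀ ∘ Opens.inclusion hVU with hΦdef
  have hΦs : ContMDiff 𝓘(ℝ, E4) (𝓡 4) ∞ Φ := hΨs.comp (contMDiff_inclusion hVU)
  have hdΦ : ∀ x : V, mfderiv 𝓘(ℝ, E4) (𝓡 4) Φ x =
      mfderiv 𝓘(ℝ, E4) (𝓡 4) Ψ₀ (Opens.inclusion hVU x) := fun x ↦
    mfderiv_comp_inclusion hVU x (hΨs.mdifferentiableAt (by simp))
  have hrange : range Φ = Ψ₀ '' (Minkowski.backgroundOn U₀).lateRegion τ₀ :=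
    range_comp_inclusion hVU Ψ₀ hVmem
  have hWopen : IsOpen (range Φ) := by
    rw [hrange, ← Set.range_restrict]
    exact hemb.isOpen_range
  have hinj : Injective Φ := by
    intro x₁ x₂ h
    have h' : (⟨Opens.inclusion hVU x₁, hlate x₁⟩ :
        (Minkowski.backgroundOn U₀).lateRegion τ₀) = ⟨Opens.inclusion hVU x₂, hlate x₂⟩ :=
      hemb.injective h
    exact Subtype.ext (congrArg (fun y : (Minkowski.backgroundOn U₀).lateRegion τ₀ ↦
      (y.1 : E4)) h')
  have hloc : IsLocalDiffeomorph 𝓘(ℝ, E4) (𝓡 4) ∞ Φ := fun x ↦ by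
    have hinjd : Injective (mfderiv 𝓘(ℝ, E4) (𝓡 4) Φ x) := by
      rw [hdΦ x]
      exact mfderiv_injective_of_deviation Ψ₀ _ (hdev _ (hlate x))
    set A : E4 →L[ℝ] E4 := mfderiv 𝓘(ℝ, E4) (𝓡 4) Φ x with hA
    have hinjA : Injective (A : E4 →ₗ[ℝ] E4) := hinjd
    have hbij : Bijective (A : E4 →ₗ[ℝ] E4) :=
      ⟨hinjA, LinearMap.injective_iff_surjective.1 hinjA⟩
    set e : E4 ≃L[ℝ] E4 := (LinearEquiv.ofBijective (A : E4 →ₗ[ℝ] E4) hbij).toContinuousLinearEquiv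
      with he
    exact Literature.Geometry.Manifold.isLocalDiffeomorphAt_of_mfderiv (by simp) isOpen_univ
      (mem_univ x) hΦs.contMDiffOn e (by ext v; rfl)
  have hcone : ∀ (x : V) (w : E4), 𝓢.metric.IsTimelike (mfderiv 𝓘(ℝ, E4) (𝓡 4) Φ x w) →
      𝓢.timeOrientation.IsFutureDirected (mfderiv 𝓘(ℝ, E4) (𝓡 4) Φ x w) →
      0 < w 0 ∧ ‖w‖ < 2 * w 0 := by
    intro x w ht hf
    rw [hdΦ x] at ht hf
    exact cone_of_deviation Ψ₀ (Opens.inclusion hVU x) (hdev _ (hlate x)) (hfut _ (hlate x)) w ht hf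
  have hvert : ∀ x : V, 𝓢.metric.val (Φ x) (mfderiv 𝓘(ℝ, E4) (𝓡 4) Φ x (E4.basisVector 0))
        (mfderiv 𝓘(ℝ, E4) (𝓡 4) Φ x (E4.basisVector 0)) ≤ -(3 / 4) ∧
      𝓢.timeOrientation.IsFutureDirected (mfderiv 𝓘(ℝ, E4) (𝓡 4) Φ x (E4.basisVector 0)) := by
    intro x
    rw [hdΦ x]
    exact ⟨val_mfderiv_basisVector_zero_le Ψ₀ _ (hdev _ (hlate x)), hfut _ (hlate x)⟩
  have hWS' : range Φ ⊆ 𝓢.metric.causalFuture 𝓢.timeOrientation S := hrange ▸ hWS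
  refine ⟨?_, ?_⟩
  · rintro q ⟨p, hp, γ, a, b, hab, hγ, hγa, hγb⟩
    rw [← hrange] at hp ⊢
    obtain ⟨x₀, hx₀⟩ := hp
    obtain ⟨x₁, hx₁, -⟩ := exists_endpoint hΦs hinj hloc hcone hVmem hWopen hvert hsc hK hWS' hab hγ
      x₀ (hγa.trans hx₀.symm)
    exact ⟨x₁, hx₁.symm.trans hγb⟩
  · rintro τ hτ q ⟨p, ⟨y₀, hy₀, rfl⟩, γ, a, b, hab, hγ, hγa, hγb⟩
    have hy₀' : (y₀ : E4) 0 = τ := hy₀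
    set x₀ : V := ⟨(y₀ : E4), (hVmem _).2 (hy₀'.symm ▸ hτ)⟩ with hx₀
    have hΦx₀ : Φ x₀ = Ψ₀ y₀ := congrArg Ψ₀ (Subtype.ext rfl)
    obtain ⟨x₁, hx₁, hlt⟩ := exists_endpoint hΦs hinj hloc hcone hVmem hWopen hvert hsc hK hWS' hab
      hγ x₀ (hγa.trans hΦx₀.symm)
    refine ⟨Opens.inclusion hVU x₁, ?_, hx₁.symm.trans hγb⟩
    show τ < (x₁ : E4) 0
    rw [← hy₀']
    exact hlt

end FutureSet

/-! ### The stub -/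

/-- **Future set** (registered stub `stub_futureSet` of crux stmt-FinalStateConjecture-14665,
`AnchorCone → ChartFuture → FutureSet` unfolded). -/
theorem stub_futureSet :
    (∀ (X : Type) [TopologicalSpace X] [ChartedSpace E3 X] [IsManifold (𝓡 3) ∞ X] [T2Space X]
      [SecondCountableTopology X] [ConnectedSpace X],
      ∀ D ∈ admissibleVacuumData X, ∀ 𝒟 : VacuumCauchyDevelopment D, 𝒟.IsMaximal →
        ∀ (O : Set 𝒟.carrier) (τ₀ : ℝ) (U₀ : Opens E4) (Ψ₀ : U₀ → 𝒟.carrier),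
          (𝒟.toSpacetime.IsLateChart (Minkowski.backgroundOn U₀) O τ₀ Ψ₀ ∧
            {x : E4 | τ₀ < x 0} ⊆ (U₀ : Set E4) ∧
            O = Summit.FinalStateConjecture.exteriorOf 𝒟.toCauchyDevelopment
              (Ψ₀ '' (Minkowski.backgroundOn U₀).lateRegion τ₀) ∧
            (∀ τ₁ : ℝ, τ₀ < τ₁ → O \ Ψ₀ '' (Minkowski.backgroundOn U₀).lateRegion τ₁ ⊆
              𝒟.metric.causalPast 𝒟.timeOrientation
                (Ψ₀ '' (Minkowski.backgroundOn U₀).timeSlab τ₁)) ∧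
            (∀ τ : ℝ, τ₀ < τ → 𝒟.toSpacetime.deviationCk (Minkowski.backgroundOn U₀) Ψ₀ 0 τ ≤
              ENNReal.ofReal (1 / 4))) →
          (∀ x : U₀, τ₀ < x.1 0 →
            ‖𝒟.toSpacetime.deviation (Minkowski.backgroundOn U₀) Ψ₀ x‖ ≤ 1 / 4)) →
    (∀ (X : Type) [TopologicalSpace X] [ChartedSpace E3 X] [IsManifold (𝓡 3) ∞ X] [T2Space X]
      [SecondCountableTopology X] [ConnectedSpace X],
      ∀ D ∈ admissibleVacuumData X, ∀ 𝒟 : VacuumCauchyDevelopment D, 𝒟.IsMaximal →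
        ∀ (O : Set 𝒟.carrier) (τ₀ : ℝ) (U₀ : Opens E4) (Ψ₀ : U₀ → 𝒟.carrier),
          (𝒟.toSpacetime.IsLateChart (Minkowski.backgroundOn U₀) O τ₀ Ψ₀ ∧
            {x : E4 | τ₀ < x 0} ⊆ (U₀ : Set E4) ∧
            O = Summit.FinalStateConjecture.exteriorOf 𝒟.toCauchyDevelopment
              (Ψ₀ '' (Minkowski.backgroundOn U₀).lateRegion τ₀) ∧
            (∀ τ₁ : ℝ, τ₀ < τ₁ → O \ Ψ₀ '' (Minkowski.backgroundOn U₀).lateRegion τ₁ ⊆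
              𝒟.metric.causalPast 𝒟.timeOrientation
                (Ψ₀ '' (Minkowski.backgroundOn U₀).timeSlab τ₁)) ∧
            (∀ τ : ℝ, τ₀ < τ → 𝒟.toSpacetime.deviationCk (Minkowski.backgroundOn U₀) Ψ₀ 0 τ ≤
              ENNReal.ofReal (1 / 4))) →
          (∀ x : U₀, τ₀ < x.1 0 →
            𝒟.timeOrientation.IsFutureDirected
              (mfderiv 𝓘(ℝ, E4) (𝓡 4) Ψ₀ x (E4.basisVector 0)))) →
    ∀ (X : Type) [TopologicalSpace X] [ChartedSpace E3 X] [IsManifold (𝓡 3) ∞ X] [T2Space X]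
      [SecondCountableTopology X] [ConnectedSpace X],
      ∀ D ∈ admissibleVacuumData X, ∀ 𝒟 : VacuumCauchyDevelopment D, 𝒟.IsMaximal →
        ∀ (O : Set 𝒟.carrier) (τ₀ : ℝ) (U₀ : Opens E4) (Ψ₀ : U₀ → 𝒟.carrier),
          (𝒟.toSpacetime.IsLateChart (Minkowski.backgroundOn U₀) O τ₀ Ψ₀ ∧
            {x : E4 | τ₀ < x 0} ⊆ (U₀ : Set E4) ∧
            O = Summit.FinalStateConjecture.exteriorOf 𝒟.toCauchyDevelopment
              (Ψ₀ '' (Minkowski.backgroundOn U₀).lateRegion τ₀) ∧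
            (∀ τ₁ : ℝ, τ₀ < τ₁ → O \ Ψ₀ '' (Minkowski.backgroundOn U₀).lateRegion τ₁ ⊆
              𝒟.metric.causalPast 𝒟.timeOrientation
                (Ψ₀ '' (Minkowski.backgroundOn U₀).timeSlab τ₁)) ∧
            (∀ τ : ℝ, τ₀ < τ → 𝒟.toSpacetime.deviationCk (Minkowski.backgroundOn U₀) Ψ₀ 0 τ ≤
              ENNReal.ofReal (1 / 4))) →
          (𝒟.metric.chronologicalFuture 𝒟.timeOrientation
              (Ψ₀ '' (Minkowski.backgroundOn U₀).lateRegion τ₀) ⊆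
            Ψ₀ '' (Minkowski.backgroundOn U₀).lateRegion τ₀) ∧
          (∀ τ : ℝ, τ₀ < τ →
            𝒟.metric.chronologicalFuture 𝒟.timeOrientation
                (Ψ₀ '' (Minkowski.backgroundOn U₀).timeSlab τ) ⊆
              Ψ₀ '' (Minkowski.backgroundOn U₀).lateRegion τ) := by
  intro hA hCF X _ _ _ _ _ _ D hD 𝒟 hmax O τ₀ U₀ Ψ₀ hyp
  -- the pointwise anchor and the orientation of the chart time (neighbours, hypotheses 1 and 2)
  have hdev : ∀ y : U₀, τ₀ < y.1 0 →
      ‖𝒟.toSpacetime.deviation (Minkowski.backgroundOn U₀) Ψ₀ y‖ ≤ 1 / 4 :=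
    hA X D hD 𝒟 hmax O τ₀ U₀ Ψ₀ hyp
  have hfut : ∀ y : U₀, τ₀ < y.1 0 →
      𝒟.timeOrientation.IsFutureDirected (mfderiv 𝓘(ℝ, E4) (𝓡 4) Ψ₀ y (E4.basisVector 0)) :=
    hCF X D hD 𝒟 hmax O τ₀ U₀ Ψ₀ hyp
  obtain ⟨hchart, hU, hO, -, -⟩ := hyp
  -- the late image lies in `O ⊆ J⁺(Σ)`
  have hWS : Ψ₀ '' (Minkowski.backgroundOn U₀).lateRegion τ₀ ⊆
      𝒟.metric.causalFuture 𝒟.timeOrientation (range 𝒟.embed) := by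
    intro q hq
    have h2 : q ∈ O := hchart.image_subset hq
    rw [hO] at h2
    exact h2.1
  exact FutureSet.futureSet_of_chart (𝓢 := 𝒟.toSpacetime) 𝒟.toCauchyDevelopment.isStronglyCausal
    𝒟.toCauchyDevelopment.isCompact_causalPast_inter_causalFuture_range hchart.contMDiff
    hchart.isOpenEmbedding hU hdev hfut hWS


end Summit.FinalStateConjecture.FinalStateConjecture.Theorems.RecurrentlyFlatDisperses

end
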